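import Summits.BirchSwinnertonDyer.BirchSwinnertonDyer.Theses.PAdicOrder
import Summits.BirchSwinnertonDyer.BirchSwinnertonDyer.Theses.PAdicOrderV2
import Summits.BirchSwinnertonDyer.BirchSwinnertonDyer.Theses.LeadingTerm
import Summits.BirchSwinnertonDyer.BirchSwinnertonDyer.Theorems.LeadingTermPinchPrimePinchAtOfSamePrime
import Summits.BirchSwinnertonDyer.BirchSwinnertonDyer.Theorems.PAdicOrderThesisR2.Negative.AtEveryGoodPrimeFalse
import Summits.BirchSwinnertonDyer.BirchSwinnertonDyer.Theorems.PAdicOrderV2PAdicOrderThesisR2StubRankRegulatorOfNonSquarePair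
import Literature.Barriers.BirchSwinnertonDyer.SelmerVersusMordellWeilProofs
import Literature.NumberTheory.EllipticCurves.IwasawaLeadingTermProofs
import Literature.NumberTheory.EllipticCurves.CanonicalPAdicHeightHolds
import Literature.NumberTheory.EllipticCurves.OrdinaryPrimesProofs
import Literature.NumberTheory.DiophantineGeometry.Conductor

/-!
# Skeleton — line `lambda-adic-gz-square-class` (merged with its companion
# `shadow-lines-motivic-prime`) for crux `PAdicOrderThesisR2` (stmt-BirchSwinnertonDyer-0487)

X := `Summit.BirchSwinnertonDyer.BirchSwinnertonDyer.Theses.PAdicOrderV2.PAdicOrderThesisR2`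
(∀ E/ℚ globally minimal W, ∃ good ORDINARY p, ∃ newform f of W:
 ord_T L_p(f, α_p, T) = r_an(W) ∧ ord_T L_p(f, α_p, T) = r_MW(W)).

## Shape of the line (planner, crux-plan 2026-08-17)

Kernel-checked frame (Lines/Sketch-dead.md §2(c); `thesis_iff_bsd_and_onePrimeComparison`,
p136391; `thesisFiveLe_iff_bsd_and_pinchPrime`, p134995): X = BSD-rank(gm) ∧ [one good ordinary
prime per curve with ord_T L_p = rank]. The second conjunct is route LeadingTerm's crux
`PinchPrime`, and its LANDED pointwise bridge (`stub_orderEqRankOfSchneiderShaAt`, p134300;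
`stub_pinchAt_of_samePrime`, p138339) reduces it — modulo five theorem-grade named facts — to the
SAME-PRIME RESIDUAL: at ONE good ordinary `p ≥ 5` with `E[p]` irreducible, `Ш(E/ℚ)[p^∞]` is
finite and the canonical cyclotomic height is non-degenerate ((J) on analytic rank ≥ 2, (S″) on
non-CM analytic rank 1). So every line for X must produce, sector by sector,
BSD-rank + Ш[p^∞]-finiteness + Schneider at one prime. THIS line does so WITH AN OBJECT on the
first open sector {non-CM, r_an = 2} (the idea), imports the known sectors (r_an ≤ 1: GZK,
Bertrand, rank 0) from the landed LeadingTerm glue, keeps the non-CM rank-1 height prime as the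
sibling stub it already is (wieferich-jet / PAdicOrderRankOneR4 / PinchPrime (S″)), and DECLARES
the remaining sectors {CM, r_an = 2} ∪ {r_an ≥ 3} BARE (one stub, flagged; no mechanism claimed).

## STATUS (lead seat a2, end of cycle 1, 2026-08-17T10Z) — 4 sorries = F, S″, K, R; LINE DEAD at R (L5(3))

* G `stub_rank_regulator_of_nonSquarePair` LANDED p148465 (wave 1) and is imported; its file also
  lands the reusable coordinate expansion `pairing_eq_sum_sum` / `exists_coords`.
* K (held by the lead): TIGHTNESS LANDED p151786 (`…StubShadowPrimeTightness.lean`,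
  `shadowPrime_iff_sector`): on {non-CM, r_an = 2}, K ⟺ (r_MW = 2 ∧ (J) at one good ordinary
  irreducible p ≥ 5) — typed K is the sector target in the currency of square classes, neither
  stronger nor weaker (via `exists_nonSquarePair_of_rank_two`: rank 2 ∧ Reg_p ≠ 0 ⟹ non-square
  height pair, and the new Literature file `QuadraticForms/PadicBinaryFormSquareClasses`, p151366).
  K itself stays OPEN (= BSD-rank ∧ Ш[p^∞]-finite ∧ Schneider on its sector; mechanism = Howard's
  Λ-adic Gross–Zagier square classes, now TYPABLE against D1 `TwoVariablePAdicLFunctionK` / D2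
  `AnticyclotomicCompactSelmer` but not provable: Howard 2005 Thm 2 element identity + projection
  formula, Cornut–Vatsal non-triviality, control of pr₀ are not vendored).
* S″: TIGHTNESS LANDED p152081 (`…StubRankOneSchneiderTightness.lean`): MW-rank-1 form of S″ ⟺ one
  admissible point with ĥ_p ≠ 0 at an ordinary irreducible p ≥ 5 per curve; S″ ⟸ GZK + that
  witness. S″ itself OPEN (= stub H of crux #5 stmt-0515 / S′ of PinchPrime stmt-16218, + GZK).
* R: wiring of its homes LANDED p149889 (`stub_residualSectors_of_items`, `…_of_routeItems`,
  `…_of_higherGZItems`, `…_of_leadingTermItems`, gap theorem `residualSectorsMinus_of_bsd_pinchPrime`: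
  BSDgm ∧ PinchPrime give R MINUS irreducibility at the witness prime) — R itself BARE/open.
* F stub-blocked (no `_holds` for any of the five facts, audit 07:33Z).
Record: `Lines/lambda-adic-gz-square-class.dead.md`.

## The stubs (5 registered at plan time; 4 open)

* `stub_theoremGradeFacts` (FACTS, in print, unvendored): modularity `exists_isNewformOf`
  (BCDT 2001), the order main conjecture in Λ⊗ℚ_p under irreducibility
  `burungale_castella_skinner_charIdeal_eq_padicLFunction` (BCS 2025 Thm 1.1.2(a); VERBATIM the
  route item `PAdicOrderMainConjectureR5`, stmt-15418), Perrin-Riou–Schneider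
  `Schneider1985_order_charGenerator` (BMS 2016 Thm 1.7), Gross–Zagier–Kolyvagin
  `rank_eq_analyticRank_of_analyticRank_le_one`, Bertrand `bertrand_pairing_self_ne_zero_of_hasCM`
  — the SAME conjunction as the registered facts stub of crux `PinchPrime`, line `SketchIdeator2`
  (one proof serves both lines).
* `stub_rankOne_schneiderPrime` (OPEN, sibling sector, = (S″) of `stub_pinchAt_of_samePrime`
  verbatim): every non-CM curve of analytic rank 1 has ONE good ordinary `p ≥ 5`, `E[p]`
  irreducible, with `Reg_p ≠ 0` (`h_p(P) ≠ 0` for the generator; Mazur–Stein–Tate 2006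
  Conj. 1.1 in `∃p` form; supplier idea `wieferich-jet`; = crux #5 `PAdicOrderRankOneR4` in its
  `∃p`-weakening via Perrin-Riou 1987).
* `stub_shadowPrime_rankTwo` (OPEN — THE IDEA, hardest): every NON-CM curve of analytic rank 2
  has ONE good ordinary `p ≥ 5` with `E[p]` irreducible at which (i) `corank_{ℤ_p} Sel_{p^∞}(E/ℚ)
  ≤ 2` and (ii) there are rational points `P, Q` whose canonical cyclotomic `p`-adic heights are
  non-zero with NON-SQUARE ratio in `ℚ_p^×`. This is the typed projection onto existing tree
  objects of [UNMW(K) ∧ UNMW(K′) ∧ NC₂⁎(p)] for two admissible Heegner fields K, K′: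
  NC₂⁎(p) = "c(K)·c(K′) ≠ 0 with c(K)/c(K′) ∉ (ℚ_p^×)²", c(K) := [T²] e(ℒ_{f,1}(K)) the leading
  anticyclotomic Taylor coefficient of the first cyclotomic derivative of the Hida–Perrin-Riou
  two-variable p-adic L-function; by Howard's Λ-adic Gross–Zagier theorem (Compositio 141 (2005)
  = arXiv:1202.6349, Thm 2: `κ·log_p(γ₀)·ℒ_{f,1} = ℒ_Heeg`, an equality of ELEMENTS; p. 5:
  `e(ℒ_Heeg)Λ_anti = 𝔥_∞(ỹ_∞,ỹ_∞)Λ_anti = char(S_∞/ℋ)·char(S_∞/ℋ)^ι·ℛ`, `S_∞` free of rank one)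
  and sesquilinearity, c(K) = −2(deg φ·log_p γ₀)⁻¹·w_K(0)²·h^{cyc}_ℚ(g₀(K), g₀(K)) where g₀(K)
  spans the Selmer shadow line ℓ_K; c(K) ≠ 0 ⟹ k_K = 1 ⟹ (Howard, Compositio 140 (2004) =
  arXiv:1202.6340, (1.1): `rank_{ℤ_p} S_p(E/K) ≤ 1 + 2·ord_J 𝐋`, + GZK for the twist E^K)
  s_p(E/ℚ) ≤ 2 — conjunct (i); UNMW (companion card: ⟸ `BoundedCapitulation`) puts g₀(K),
  g₀(K′) in E(ℚ)⊗ℚ_p, the square class of c(K) is an invariant of the LINE ℓ_K, and density of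
  E(ℚ) in E(ℚ)⊗ℤ_p turns the two lines into rational points — conjunct (ii). (The intermediate
  statements UNMW / NC₂⁎ need definitions the tree lacks — D1 two-variable ℒ_f(K) / e(ℒ_{f,1}),
  D2 compact Λ_ac-adic Selmer S_∞(K) with base projection — requested; see the line card.)
* `stub_rank_regulator_of_nonSquarePair` (GLUE, provable now, linear algebra over ℚ_p): two
  points with non-zero heights of non-square ratio are independent modulo torsion (`2 ≤ r_MW`),
  and if `r_MW = 2` the Gram determinant on a Mordell–Weil basis is non-zero (a symmetric 2×2
  matrix of rank ≤ 1 over a field represents a single square class).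
* `stub_residualSectors` (BARE, declared import — NOT mechanised by this idea): BSD-rank and the
  same-prime residual (J) on analytic rank ≥ 2 OUTSIDE the non-CM rank-2 sector, i.e. for CM
  curves of analytic rank 2 and all curves of analytic rank ≥ 3 (square classes certify only
  pairwise distinctness of shadow lines; Howard's inequality is not sharp for unbalanced signs).
  Homes: split child C5 `PAdicOrderLBHigherRank` / HigherGZConstructionR2 (stmt-0501) /
  Squeeze (0144 ∧ 0146) for the rank part; PinchPrime's A′/S′ (stmt-16218) for (J).

## Composition (`PAdicOrderThesisR2_of`, sorry-free modulo the stubs)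

rank-2 non-CM sector (`shadowSector_of_stubs`): K gives p, `s_p ≤ 2` and the pair; G gives
`2 ≤ r_MW`; the squeeze `mordellWeilRank_eq_of_le_of_selmerCorank_le_holds` (tree theorem,
points first — Ш after) gives `r_MW = 2 = s_p`, `corank Ш[p^∞] = 0`, hence `Ш[p^∞]` finite
(`finite_primaryComponent_sha_iff_shaCorank_eq_zero`), and G again gives Schneider at p for every
canonical datum. BSD-rank: GZK (r_an ≤ 1) / shadow sector / residual stub. (J): shadow sector /
residual stub. Then LeadingTerm's landed `stub_pinchAt_of_samePrime` (facts + (J) + (S″) ⟹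
`PinchPrime`) and the 4-line step `PinchPrime → BSDgm → X` (as `padicOrderThesisR2_of_pinchPrime_of_bsd`,
p134995).

## Disproof used (Cruxes/PAdicOrderThesisR2/Disproof.lean, cycle-1 FINAL, md5 b1ba74b1)

No `_false_without_<H>` theorem exists for this crux. (a)/(a′) `unitRoot_eq_zero_of_dvd`,
`order_ne_analyticRank_of_dvd`: every prime produced here is good ORDINARY (`IsOrdinaryAt` kept
verbatim in K, S″, R) — honoured. (c) refuted ∀p-strengthenings
(`padicOrderThesisR2_false_at_every_good_prime`, landed p98081 and IMPORTED above as a check that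
nothing here instantiates it): every stub is `∃ p`; no stub asserts anything at a supersingular
prime. (n) `thesis_iff_bsd_and_onePrime`: respected by construction (BSDgm proved sector-wise,
OnePrimeComparison through PinchPrime). Negatives index (stmt-15532 `TamePinch`, CM witness 32a2):
no stub carries a surjectivity conjunct under `∀ W`; K and S″ carry `¬ W.HasCM`, CM rank ≤ 1 is
Bertrand (facts), CM rank 2 sits in the bare residual with only `E[p]` IRREDUCIBLE inside `∃p`
(true for every E/ℚ at all p > 163, Mazur; tree: `exists_forall_hasIrreducibleModPGaloisRep_of_lt`).
-/

-- single-conjunct summit: `Summit.BirchSwinnertonDyer.BirchSwinnertonDyer.…` repeats the name by design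
set_option linter.dupNamespace false

noncomputable section

namespace Summit.BirchSwinnertonDyer.BirchSwinnertonDyer.Cruxes.PAdicOrderThesisR2.LambdaAdicGZ

open scoped MatrixGroups ModularForm
open CongruenceSubgroup
open Literature.NumberTheory.EllipticCurves Literature.NumberTheory.EllipticCurves.ModularForms
open Summit.BirchSwinnertonDyer.BirchSwinnertonDyer.Theses

/-! ## The stubs -/

/-- STUB F (FACTS — five published theorems, none yet discharged in the tree; identical to the
registered facts stub of crux `PinchPrime`, line `SketchIdeator2`): modularity (BCDT 2001 Thm A;
`exists_isNewformOf`), the cyclotomic main conjecture in `Λ ⊗ ℚ_p` at good ordinary `p ≥ 5`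
with `E[p]` irreducible (Burungale–Castella–Skinner 2025 Thm 1.1.2(a); verbatim the route item
`PAdicOrderMainConjectureR5`, stmt-BirchSwinnertonDyer-15418), the Perrin-Riou–Schneider
leading-term theorem (Balakrishnan–Müller–Stein 2016 Thm 1.7), Gross–Zagier–Kolyvagin (Darmon
2004 Thm 3.22) and Bertrand's CM height non-vanishing (LNM 1068 §3 Cor. 1). -/
theorem stub_theoremGradeFacts :
    exists_isNewformOf ∧ burungale_castella_skinner_charIdeal_eq_padicLFunction ∧
      Schneider1985_order_charGenerator ∧ rank_eq_analyticRank_of_analyticRank_le_one ∧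
      bertrand_pairing_self_ne_zero_of_hasCM := by
  sorry

/-- STUB S″ (OPEN, sibling sector — weak Schneider at ONE prime in non-CM analytic rank 1;
verbatim the antecedent (S″) of LeadingTerm's landed `stub_pinchAt_of_samePrime`): every non-CM
elliptic `E/ℚ` (globally minimal `W`) of analytic rank `1` has a good ordinary prime `p ≥ 5` with
`E[p]` irreducible at which every canonical cyclotomic `p`-adic height datum is non-degenerate
(`Reg_p(E, Dh) = h_p(P)·(index)² ≠ 0`). Mazur–Stein–Tate 2006 Conj. 1.1 (`∃p` form); supplier
idea `wieferich-jet` (jet congruence, certified j022437/j022521/j022543); CM curves are Bertrand. -/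
theorem stub_rankOne_schneiderPrime :
    ∀ (W : WeierstrassCurve ℚ) [W.IsElliptic] [W.IsGloballyMinimal], W.analyticRank = 1 →
      ¬ W.HasCM →
      ∃ (p : ℕ) (_ : Fact p.Prime), 5 ≤ p ∧ IsOrdinaryAt W p ∧ W.HasIrreducibleModPGaloisRep p ∧
        ∀ Dh : WeierstrassCurve.PAdicHeightData W p, Dh.IsCanonical →
          WeierstrassCurve.SchneiderConjecture Dh := by
  sorry

/-- STUB K (OPEN — THE IDEA `lambda-adic-gz-square-class` + companion `shadow-lines-motivic-prime`;
the load-bearing stub of the line): every NON-CM elliptic `E/ℚ` (globally minimal `W`) of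
analytic rank `2` has a good ordinary prime `p ≥ 5` with `E[p]` irreducible such that
(i) `corank_{ℤ_p} Sel_{p^∞}(E/ℚ) ≤ 2`, and (ii) for the canonical cyclotomic `p`-adic height there
are rational points `P, Q` with `h_p(P) ≠ 0`, `h_p(Q) ≠ 0` and `h_p(P)/h_p(Q)` NOT a square in
`ℚ_p`. Intended proof (paper route, see the module docstring and `Lines/lambda-adic-gz-square-class.md`):
two admissible Heegner fields `K, K′` (D odd ≠ −3, all ℓ ∣ N split, p split, p ∤ h_K,
`Gal(K̄/K) ↠ Aut T_pE`, r_an(E^K) = r_an(E^{K′}) = 1) with `c(K)c(K′) ≠ 0`, `c(K)/c(K′) ∉ (ℚ_p^×)²`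
(NC₂⁎: c(K) = [T²] e(ℒ_{f,1}(K)), Howard 2005 Thm 2 + p. 5) give (i) via Howard 2004 (1.1) and
distinct Selmer shadow lines with `h^{cyc} ≠ 0`; `UNMW(K) ∧ UNMW(K′)` (⟸ `BoundedCapitulation`)
makes the lines Mordell–Weil; density of `E(ℚ)` in `E(ℚ) ⊗ ℤ_p` yields `P, Q`. Numerical witness of
conjunct (ii) (kit j022801 + j022825, PARI `ellpadicheight`, canonical = `f − s₂·g`): at 34/34 tested
ordinary pairs (6 rank-2 curves of conductor ≤ 1034 and 5077a1; 5 ≤ p ≤ 19) two rational points with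
non-square height ratio exist among small combinations of two independent points (rare — 8/184 — only
at the two ANOMALOUS pairs, a_p ≡ 1 mod p, where the heights acquire the denominator p).
[cite: arXiv:1202.6349, Thm 2 and p. 5] [cite: arXiv:1202.6340, (1.1) p. 3] -/
theorem stub_shadowPrime_rankTwo :
    ∀ (W : WeierstrassCurve ℚ) [W.IsElliptic] [W.IsGloballyMinimal], ¬ W.HasCM →
      W.analyticRank = 2 →
      ∃ (p : ℕ) (_ : Fact p.Prime), 5 ≤ p ∧ IsOrdinaryAt W p ∧ W.HasIrreducibleModPGaloisRep p ∧
        W.selmerCorank p ≤ 2 ∧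
        ∀ Dh : WeierstrassCurve.PAdicHeightData W p, Dh.IsCanonical →
          ∃ P Q : W.toAffine.Point, Dh.pairing P P ≠ 0 ∧ Dh.pairing Q Q ≠ 0 ∧
            ¬ IsSquare (Dh.pairing P P / Dh.pairing Q Q) := by
  sorry

/- STUB G (GLUE) `stub_rank_regulator_of_nonSquarePair` — LANDED (wave 1, p148465, ACCEPTED 2026-08-17T08:17Z,
`Theorems/PAdicOrderV2PAdicOrderThesisR2StubRankRegulatorOfNonSquarePair.lean`, same namespace, imported above):
for any symmetric biadditive torsion-vanishing pairing `D` on `E(ℚ)`, two points with non-zero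
self-pairings of NON-SQUARE ratio give `2 ≤ rank_ℤ E(ℚ)`, and `rank_ℤ E(ℚ) = 2 → Reg_p(E, D) ≠ 0`.
The uses below resolve to the landed theorem. -/

/-- STUB R (BARE RESIDUAL — declared import, no mechanism from this idea): for an elliptic `E/ℚ`
(globally minimal `W`) of analytic rank `≥ 2` OUTSIDE the non-CM rank-2 sector (i.e. `E` has CM
and `r_an = 2`, or `r_an ≥ 3`): `rank_ℤ E(ℚ) = r_an` and there is ONE good ordinary `p ≥ 5` with
`E[p]` irreducible, `Ш(E/ℚ)[p^∞]` finite and the canonical cyclotomic height non-degenerate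
(= BSD-rank ∧ the same-prime residual (J) of `PinchPrime` on that range). Homes: split child C5
`PAdicOrderLBHigherRank`, HigherGZConstructionR2 (stmt-0501), Squeeze (stmt-0144 ∧ 0146) for the
rank; PinchPrime A′/S′ (stmt-16218) for (J). A lead meets prover L5(3) HERE, by design. -/
theorem stub_residualSectors :
    ∀ (W : WeierstrassCurve ℚ) [W.IsElliptic] [W.IsGloballyMinimal], 2 ≤ W.analyticRank →
      (W.analyticRank = 2 → W.HasCM) →
      W.mordellWeilRank = W.analyticRank ∧
        ∃ (p : ℕ) (_ : Fact p.Prime), 5 ≤ p ∧ IsOrdinaryAt W p ∧ W.HasIrreducibleModPGaloisRep p ∧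
          Finite (AddCommGroup.primaryComponent W.sha p) ∧
          ∀ Dh : WeierstrassCurve.PAdicHeightData W p, Dh.IsCanonical →
            WeierstrassCurve.SchneiderConjecture Dh := by
  sorry

/-! ## The rank-2 non-CM sector from K and G (sorry-free modulo the stubs) -/

/-- **The shadow sector.** For a non-CM curve of analytic rank `2`, stubs K and G give
`rank_ℤ E(ℚ) = 2` AND the same-prime residual (J): at the prime of K, `2 ≤ r_MW` (G) and
`corank Sel_{p^∞} ≤ 2` (K) squeeze to `r_MW = 2 = corank Sel_{p^∞}`, `corank Ш[p^∞] = 0`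
(`mordellWeilRank_eq_of_le_of_selmerCorank_le_holds`: points first, `Ш` after), so `Ш[p^∞]` is
finite (`finite_primaryComponent_sha_iff_shaCorank_eq_zero`), and G gives `Reg_p ≠ 0` for every
canonical datum. [cite: GreenbergLNM1716, §1] -/
theorem shadowSector_of_stubs (W : WeierstrassCurve ℚ) [W.IsElliptic] [W.IsGloballyMinimal]
    (hCM : ¬ W.HasCM) (h2 : W.analyticRank = 2) :
    W.mordellWeilRank = 2 ∧
      ∃ (p : ℕ) (_ : Fact p.Prime), 5 ≤ p ∧ IsOrdinaryAt W p ∧ W.HasIrreducibleModPGaloisRep p ∧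
        Finite (AddCommGroup.primaryComponent W.sha p) ∧
        ∀ Dh : WeierstrassCurve.PAdicHeightData W p, Dh.IsCanonical →
          WeierstrassCurve.SchneiderConjecture Dh := by
  obtain ⟨p, hp, h5, hord, hirr, hsel, hpair⟩ := stub_shadowPrime_rankTwo W hCM h2
  -- a canonical datum exists at the good ordinary prime `p ≥ 5` (tree theorem)
  obtain ⟨D₀, hD₀⟩ := WeierstrassCurve.exists_isCanonical_holds W p h5 hord.1 hord.2
  have hG₀ := stub_rank_regulator_of_nonSquarePair W p D₀ (hpair D₀ hD₀)
  -- the squeeze at one prime: `2 ≤ r_MW` and `corank Sel_{p^∞} ≤ 2`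
  have hsq := Literature.Barriers.BirchSwinnertonDyer.mordellWeilRank_eq_of_le_of_selmerCorank_le_holds
    W p hG₀.1 hsel
  refine ⟨hsq.1, p, hp, h5, hord, hirr, ?_, fun Dh hDh ↦ ?_⟩
  · exact (finite_primaryComponent_sha_iff_shaCorank_eq_zero W p).mpr hsq.2.2
  · exact (stub_rank_regulator_of_nonSquarePair W p Dh (hpair Dh hDh)).2 hsq.1

/-! ## BSD-rank and the same-prime residual (J), sector by sector -/

/-- **BSD-rank for globally minimal models from the stubs**: analytic rank `≤ 1` by
Gross–Zagier–Kolyvagin (facts), the non-CM rank-2 sector by `shadowSector_of_stubs`, the rest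
by the bare residual stub. [cite: Darmon2004, Thm. 3.22] -/
theorem bsd_of_stubs :
    ∀ (W : WeierstrassCurve ℚ) [W.IsElliptic] [W.IsGloballyMinimal],
      W.analyticRank = W.mordellWeilRank := by
  obtain ⟨-, -, -, hGZK, -⟩ := stub_theoremGradeFacts
  intro W _ _
  by_cases h1 : W.analyticRank ≤ 1
  · exact (hGZK W h1).1.symm
  by_cases hS : W.analyticRank = 2 ∧ ¬ W.HasCM
  · exact hS.1.trans (shadowSector_of_stubs W hS.2 hS.1).1.symm
  · have h2 : 2 ≤ W.analyticRank := by omega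
    have hres : W.analyticRank = 2 → W.HasCM := fun h ↦ by
      by_contra hc
      exact hS ⟨h, hc⟩
    exact (stub_residualSectors W h2 hres).1.symm

/-- **The same-prime residual (J) on analytic rank `≥ 2` from the stubs**: the non-CM rank-2
sector by `shadowSector_of_stubs`, the rest by the bare residual stub.
[cite: MazurSteinTate2006, Conj. 1.1] -/
theorem samePrimeJ_of_stubs :
    ∀ (W : WeierstrassCurve ℚ) [W.IsElliptic] [W.IsGloballyMinimal], 2 ≤ W.analyticRank →
      ∃ (p : ℕ) (_ : Fact p.Prime), 5 ≤ p ∧ IsOrdinaryAt W p ∧ W.HasIrreducibleModPGaloisRep p ∧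
        Finite (AddCommGroup.primaryComponent W.sha p) ∧
        ∀ Dh : WeierstrassCurve.PAdicHeightData W p, Dh.IsCanonical →
          WeierstrassCurve.SchneiderConjecture Dh := by
  intro W _ _ h2
  by_cases hS : W.analyticRank = 2 ∧ ¬ W.HasCM
  · exact (shadowSector_of_stubs W hS.2 hS.1).2
  · have hres : W.analyticRank = 2 → W.HasCM := fun h ↦ by
      by_contra hc
      exact hS ⟨h, hc⟩
    exact (stub_residualSectors W h2 hres).2

/-- **`LeadingTerm.PinchPrime` from the stubs**, through LeadingTerm's landed same-prime bridge
`stub_pinchAt_of_samePrime` (p138339): facts + (J) + (S″). [cite: BalakrishnanMullerStein2015, Thm. 1.7] -/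
theorem pinchPrime_of_stubs : LeadingTerm.PinchPrime := by
  obtain ⟨hmod, hBCS, hPRS, hGZK, hBer⟩ := stub_theoremGradeFacts
  intro W _ _
  exact _root_.Summit.BirchSwinnertonDyer.BirchSwinnertonDyer.Cruxes.PinchPrime.FirstLayerStability.stub_pinchAt_of_samePrime
    hPRS hmod hBCS hGZK hBer samePrimeJ_of_stubs stub_rankOne_schneiderPrime W

/-! ## Composition -/

/-- **Composition.** The crux `PAdicOrderThesisR2` from the five stubs: at the pinch prime of
`pinchPrime_of_stubs`, `ord_T L_p(f, α_p, T) = r_MW(W)` for a newform `f`, and `r_an(W) = r_MW(W)`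
by `bsd_of_stubs` (the 4-line step of `padicOrderThesisR2_of_pinchPrime_of_bsd`, p134995).
[cite: MazurTateTeitelbaum1986Invent, §II.10] -/
theorem PAdicOrderThesisR2_of : PAdicOrderV2.PAdicOrderThesisR2 := by
  intro W _ _
  obtain ⟨p, hp, -, hord, -, -, N, hN, f, hf, horder⟩ := pinchPrime_of_stubs W
  refine ⟨p, hp, hord, N, hN, f, hf, ?_, horder⟩
  rw [horder, bsd_of_stubs W]

/-- **Composition, route `PAdicOrder` spelling** (the crux item stmt-0487 is wanted by both
routes under byte-identical decls; `Iff.rfl`). -/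
theorem PAdicOrderThesisR2_proof : PAdicOrder.PAdicOrderThesisR2 :=
  PAdicOrderThesisR2_of

end Summit.BirchSwinnertonDyer.BirchSwinnertonDyer.Cruxes.PAdicOrderThesisR2.LambdaAdicGZ

end
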